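import Mathlib.LinearAlgebra.Semisimple
import Mathlib.LinearAlgebra.JordanChevalley
import Mathlib.LinearAlgebra.Charpoly.Basic
import Mathlib.LinearAlgebra.Matrix.Charpoly.Coeff
import Mathlib.LinearAlgebra.Dual.Defs
import Mathlib.LinearAlgebra.FreeModule.Finite.Matrix
import Mathlib.RingTheory.Nilpotent.Defs
import Mathlib.RingTheory.Nilpotent.Basic
import Mathlib.RingTheory.Nilpotent.Exp
import Mathlib.RepresentationTheory.Basic
import Mathlib.RepresentationTheory.Intertwining
import Mathlib.RepresentationTheory.Invariants
import Mathlib.FieldTheory.Perfect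
import Mathlib.Analysis.Normed.Field.Basic
import Mathlib.Analysis.SpecialFunctions.Pow.Complex
import Literature.NumberTheory.GaloisRepresentations.WeilGroup
import Literature.NumberTheory.GaloisRepresentations.ContinuousRep
import HarnessLib

-- provenance: harness21/H21/H21/Prelude/GalRep/WeilDeligneRep.lean @ 0f964ca (interim HEAD d8f2665); M5 mechanical rewrite
/-!
# Weil–Deligne representations (trunk GalRep, item C8; notion `weil_deligne_rep`)

Let `F` be a non-archimedean local field with Weil group `W_F = Literature.WeilGroup F` (item C7),
inertia `I_F = WeilGroup.inertia F`, residue cardinality `q = residueFieldCard F` and degree map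
`deg : W_F → ℤ` (arithmetic Frobenius has `deg = +1`, geometric Frobenius `deg = -1`,
`‖w‖ = q ^ deg w`; sign convention of `Literature.Prelude.GalRep.WeilGroup`).  A *Weil–Deligne
representation* of `W_F` on a vector space `V` over a field `C` of characteristic `0` is a pair
`(ρ, N)` with `ρ : W_F → GL(V)` a representation with open kernel on inertia (= continuous for
the discrete topology on `V`), `N ∈ End V` nilpotent, and
`ρ(w) N ρ(w)⁻¹ = ‖w‖ N = q ^ deg w • N` for all `w ∈ W_F`
(Deligne, *Les constantes des équations fonctionnelles des fonctions L*, Antwerp II, LNM 349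
(1973), §8.4.1; Tate, *Number theoretic background*, Corvallis 1979, (4.1.2)).

## Contents

* `Literature.WeilDeligneRep F C V`: the structure `(ρ, N)`; `ofRep` (`N = 0`), morphisms `Hom`,
  isomorphisms `Equiv`, the contragredient `dual` (on `Module.Dual C V`, `N ↦ -Nᵀ`).
* `IsFrobSemisimple` (`ρ w` semisimple for all `w`, Mathlib `Module.End.IsSemisimple`),
  `IsIrreducible`, `IsIndecomposable`, `IsFrobSemisimplificationOf` and the theorem
  `existsUnique_frobSemisimplification` (Deligne, loc. cit., 8.5–8.6; proof deferred).
* `inertiaInvariantsKerN r = (ker N)^{I_F}`, `restrictInertiaInvariantsKerN r w` (the action of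
  `w` on it, with a genuine stability proof), `eulerFactor r = det(1 - T·Φ | (ker N)^{I_F})`
  for a *geometric* Frobenius `Φ` (`deg Φ = -1`), and for `C = ℂ` the local `L`-factor
  `lFactor r s = eulerFactor r (q ^ (-s))⁻¹` (Tate, Corvallis (4.1.6); Deligne §8.12).
* Grothendieck's quasi-unipotence theorem for `ℓ`-adic representations of `W_F`,
  `FramedRep.exists_isOpen_isNilpotent_sub_one`, and the `ℓ`-adic ↦ Weil–Deligne dictionary
  `exists_weilDeligneRep_of_ladic` (Deligne §8.4.2; Serre–Tate, *Good reduction of abelian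
  varieties*, Ann. Math. 88 (1968), Appendix), both named facts (`def … : Prop`, D-0014).

## Mathlib search

Mathlib (this pin) has `Representation`, `Representation.dual`, `Representation.invariants`,
`Representation.IntertwiningMap`, `Representation.Equiv`, `Module.End.IsSemisimple`,
`Module.End.exists_isNilpotent_isSemisimple` (Jordan–Chevalley), `IsNilpotent`,
`IsNilpotent.exp` (truncated exponential on `ℚ`-algebras), `Matrix.charpolyRev`
(`det (1 - X • M)`), `LinearMap.toMatrix`, `LinearMap.restrict`; all are used below.  It has no
Weil–Deligne representations (`rg -i 'Weil.?Deligne'` has no hits).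

## Design choices

* `[CharZero C]` is a parameter of the structure (outline D3 / review 9): otherwise
  `(q : C) ^ deg w` may vanish and the defining relation degenerates.  No topology on `C`.
* The relation is stated composition-wise, `ρ w ∘ₗ N = (q : C) ^ deg w • (N ∘ₗ ρ w)` (`zpow`
  in `C`), which is Tate's `ρ(w) N ρ(w)⁻¹ = ‖w‖ N` with `‖w‖ = q ^ deg w`.
* Finite-dimensionality of `V` is *not* a field of the structure; it is assumed exactly where
  needed (`eulerFactor`, `lFactor`, `existsUnique_frobSemisimplification`), as Mathlib would.
* `eulerFactor` uses the geometric Frobenius `geomFrob F hex = WeilGroup.mk (choose (hex (-1))) …`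
  built from the `LocalGaloisGroup` named fact `hex : exists_isFrobPow` (a deliberate *thread*
  choice, no junk fallback) and the basis `Module.finBasis`; independence of both choices is the
  named fact `eulerFactor_eq`.
* `lFactor r hn hex s = (eval (q ^ (-s)) (eulerFactor r hn hex))⁻¹` uses `Complex.cpow` and the
  field convention `0⁻¹ = 0` at the (finitely many) poles; documented junk value.
* Grothendieck's monodromy theorem is a named fact, not a construction (outline D3).
* D-0014 (Literature carries no unproved proof terms): the unproved results `existsUnique_frobSemisimplification`,
  `eulerFactor_eq`, `FramedRep.exists_isOpen_isNilpotent_sub_one`,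
  `exists_weilDeligneRep_of_ladic` are named facts `def <name> : Prop := <statement>`; the
  `LocalGaloisGroup` named facts are threaded as explicit hypotheses following the accepted
  `WeilGroup` pattern: `hmul huniq` (`IsFrobPow.mul/unique`) into `dual`/`dual_N`/`dual_ρ` and
  `deg_geomFrob`; `hn : absInertia_normal F` into `ρ_apply_mem_inertiaInvariantsKerN`,
  `restrictInertiaInvariantsKerN`, `eulerFactor`, `lFactor`; `hex : exists_isFrobPow` into
  `geomFrob`, `eulerFactor`, `lFactor`.  `eulerFactor_coeff_zero` is a theorem
  (`Matrix.eval_charpolyRev`).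

## Downstream note (M5 migration)

Signature changes importers must absorb (thread the named facts explicitly, as here):
`geomFrob F` ↦ `geomFrob F hex`; `r.eulerFactor` ↦ `r.eulerFactor hn hex`;
`r.lFactor s` ↦ `r.lFactor hn hex s`; `r.dual` ↦ `r.dual hmul huniq`;
`r.restrictInertiaInvariantsKerN w` ↦ `r.restrictInertiaInvariantsKerN hn w`.  Known code sites:
`Literature/NumberTheory/Automorphic/LocalConstants.lean:357` (`geomFrob F` inside the
definition of the Frobenius determinant factor — that definition gains `hex`, and `hn` where it
restricts to inertia invariants) and `Literature/NumberTheory/Automorphic/LocalLanglandsGL.lean:226`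
(`.eulerFactor` inside a `lang`-family target statement, whose shape therefore gains `hn hex`);
`ArtinConductor`, `ModPGaloisRep`, `SerreWeight` import this file but use none of these five
declarations in code.  All these hypotheses disappear once the four `LocalGaloisGroup` facts are
discharged.
-/

noncomputable section

open scoped Nat
open Module Polynomial

namespace Literature.NumberTheory.GaloisRepresentations

variable {F : Type*} [Field F] [ValuativeRel F] [TopologicalSpace F] [IsNonarchimedeanLocalField F]

open GaloisRepresentations.IsNonarchimedeanLocalField WeilGroup

/-- A **Weil–Deligne representation** of the Weil group `W_F` of a non-archimedean local field
`F` on a `C`-vector space `V` (`C` a field of characteristic zero): a representation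
`ρ : W_F → GL(V)` which is trivial on an open subgroup of inertia (`WeilGroup.IsContinuousRep`,
i.e. continuous for the discrete topology on `V`), together with a nilpotent endomorphism `N`
of `V` satisfying `ρ(w) N ρ(w)⁻¹ = q ^ deg w • N` (`= ‖w‖ N`) for all `w ∈ W_F`.
Ref: Deligne, *Les constantes des équations fonctionnelles des fonctions L* (Antwerp II, 1973),
§8.4.1; Tate, *Number theoretic background* (Corvallis 1979), (4.1.2). [cite: II1973] -/
structure WeilDeligneRep (F : Type*) [Field F] [ValuativeRel F] [TopologicalSpace F]
    [IsNonarchimedeanLocalField F] (C : Type*) [Field C] [CharZero C] (V : Type*)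
    [AddCommGroup V] [Module C V] where
  /-- The representation of the Weil group. -/
  ρ : Representation C (WeilGroup F) V
  /-- `ρ` is trivial on an open subgroup of inertia. -/
  isContinuous : WeilGroup.IsContinuousRep ρ
  /-- The monodromy operator. -/
  N : V →ₗ[C] V
  /-- The monodromy operator is nilpotent. -/
  isNilpotent_N : IsNilpotent N
  /-- The Weil–Deligne relation `ρ(w) N = q ^ deg w • N ρ(w)`. -/
  conj_N : ∀ w : WeilGroup F, ρ w ∘ₗ N = ((residueFieldCard F : C) ^ (deg w)) • (N ∘ₗ ρ w)

namespace WeilDeligneRep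

section Basic

variable {C : Type*} [Field C] [CharZero C] {V : Type*} [AddCommGroup V] [Module C V]
  {V' : Type*} [AddCommGroup V'] [Module C V'] {V'' : Type*} [AddCommGroup V''] [Module C V'']

/-- `(q : C) ^ n ≠ 0` in a field of characteristic zero (this is where `CharZero C` is used).
Ref: Tate, *Number theoretic background* (Corvallis 1979), (4.1.2). [cite: Corvallis1979] -/
theorem residueFieldCard_zpow_ne_zero (n : ℤ) : ((residueFieldCard F : C) ^ n) ≠ 0 :=
  zpow_ne_zero n (by exact_mod_cast residueFieldCard_ne_zero F)

/-- Pointwise form of the Weil–Deligne relation: `ρ w (N v) = q ^ deg w • N (ρ w v)`.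
Ref: Deligne, Antwerp II (1973), §8.4.1. [cite: II1973] -/
theorem ρ_N_apply (r : WeilDeligneRep F C V) (w : WeilGroup F) (v : V) :
    r.ρ w (r.N v) = ((residueFieldCard F : C) ^ (deg w)) • r.N (r.ρ w v) :=
  congr($(r.conj_N w) v)

/-- The Weil–Deligne representation `(ρ, 0)` attached to a continuous representation `ρ` of
`W_F` (trivial monodromy).
Ref: Tate, *Number theoretic background* (Corvallis 1979), (4.1.3). [cite: Corvallis1979] -/
def ofRep (ρ : Representation C (WeilGroup F) V) (h : WeilGroup.IsContinuousRep ρ) :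
    WeilDeligneRep F C V where
  ρ := ρ
  isContinuous := h
  N := 0
  isNilpotent_N := IsNilpotent.zero
  conj_N w := by simp

/-- `(ofRep ρ h).N = 0`.  Ref: Tate, Corvallis 1979, (4.1.3). [cite: Corvallis1979, (4.1.3] -/
@[simp] theorem ofRep_N (ρ : Representation C (WeilGroup F) V) (h : WeilGroup.IsContinuousRep ρ) :
    (ofRep ρ h).N = 0 := rfl

/-- `(ofRep ρ h).ρ = ρ`.  Ref: Tate, Corvallis 1979, (4.1.3). [cite: Corvallis1979, (4.1.3] -/
@[simp] theorem ofRep_ρ (ρ : Representation C (WeilGroup F) V) (h : WeilGroup.IsContinuousRep ρ) :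
    (ofRep ρ h).ρ = ρ := rfl

variable (C V) in
/-- The trivial one-dimensional-type Weil–Deligne representation on `V` (`ρ = 1`, `N = 0`).
Ref: Tate, *Number theoretic background* (Corvallis 1979), (4.1.3). [cite: Corvallis1979] -/
def trivial : WeilDeligneRep F C V :=
  ofRep (Representation.trivial C (WeilGroup F) V) isContinuousRep_trivial

/-- `instance` — interim instance carried over undocumented from `harness21/H21/H21/Prelude/GalRep/WeilDeligneRep.lean:149` (docstring generated by the M5 import). [folklore] -/
instance : Inhabited (WeilDeligneRep F C V) := ⟨trivial C V⟩

/-- A **morphism of Weil–Deligne representations** `(V, ρ, N) → (V', ρ', N')`: a `C`-linear map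
intertwining the `W_F`-actions (Mathlib `Representation.IntertwiningMap`) and the monodromy
operators.  Ref: Deligne, Antwerp II (1973), §8.4.1; Tate, Corvallis 1979, (4.1.2). [cite: II1973] -/
structure Hom (r : WeilDeligneRep F C V) (r' : WeilDeligneRep F C V') extends
    Representation.IntertwiningMap r.ρ r'.ρ where
  /-- Compatibility with the monodromy operators: `f ∘ N = N' ∘ f`. -/
  comm_N : toLinearMap ∘ₗ r.N = r'.N ∘ₗ toLinearMap

namespace Hom

variable {r : WeilDeligneRep F C V} {r' : WeilDeligneRep F C V'} {r'' : WeilDeligneRep F C V''}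

variable (r) in
/-- The identity morphism.  Ref: Deligne, Antwerp II (1973), §8.4.1. [cite: II1973] -/
protected def id : Hom r r where
  __ := Representation.IntertwiningMap.id r.ρ
  comm_N := by simp

/-- Composition of morphisms.  Ref: Deligne, Antwerp II (1973), §8.4.1. [cite: II1973] -/
def comp (g : Hom r' r'') (f : Hom r r') : Hom r r'' where
  __ := g.toIntertwiningMap.comp f.toIntertwiningMap
  comm_N := by
    rw [Representation.IntertwiningMap.comp_toLinearMap, LinearMap.comp_assoc, f.comm_N,
      ← LinearMap.comp_assoc, g.comm_N, LinearMap.comp_assoc]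

/-- The linear map underlying a composition.  Ref: Deligne, Antwerp II (1973), §8.4.1. [cite: II1973] -/
@[simp] theorem comp_toLinearMap (g : Hom r' r'') (f : Hom r r') :
    (g.comp f).toLinearMap = g.toLinearMap ∘ₗ f.toLinearMap := rfl

end Hom

/-- An **isomorphism of Weil–Deligne representations**: an isomorphism of the underlying
representations (Mathlib `Representation.Equiv`) commuting with the monodromy operators.
Ref: Deligne, Antwerp II (1973), §8.4.1; Tate, Corvallis 1979, (4.1.2). [cite: II1973] -/
structure Equiv (r : WeilDeligneRep F C V) (r' : WeilDeligneRep F C V') extends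
    toRepEquiv : Representation.Equiv r.ρ r'.ρ where
  /-- Compatibility with the monodromy operators: `e ∘ N = N' ∘ e`. -/
  comm_N : toLinearMap ∘ₗ r.N = r'.N ∘ₗ toLinearMap

namespace Equiv

variable {r : WeilDeligneRep F C V} {r' : WeilDeligneRep F C V'}

/-- The morphism underlying an isomorphism.  Ref: Deligne, Antwerp II (1973), §8.4.1. [cite: II1973] -/
def toHom (e : Equiv r r') : Hom r r' where
  __ := e.toIntertwiningMap
  comm_N := e.comm_N

variable (r) in
/-- The identity isomorphism.  Ref: Deligne, Antwerp II (1973), §8.4.1. [cite: II1973] -/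
protected def refl : Equiv r r where
  __ := Representation.Equiv.refl r.ρ
  comm_N := by
    change (LinearMap.id : V →ₗ[C] V) ∘ₗ r.N = r.N ∘ₗ LinearMap.id
    simp

/-- The inverse isomorphism.  Ref: Deligne, Antwerp II (1973), §8.4.1. [cite: II1973] -/
protected def symm (e : Equiv r r') : Equiv r' r where
  __ := e.toRepEquiv.symm
  comm_N := by
    change (e.toLinearEquiv.symm : V' →ₗ[C] V) ∘ₗ r'.N = r.N ∘ₗ (e.toLinearEquiv.symm : V' →ₗ[C] V)
    have h : (e.toLinearEquiv : V →ₗ[C] V') ∘ₗ r.N = r'.N ∘ₗ (e.toLinearEquiv : V →ₗ[C] V') :=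
      e.comm_N
    rw [LinearEquiv.eq_comp_toLinearMap_symm, LinearMap.comp_assoc,
      LinearEquiv.toLinearMap_symm_comp_eq, h]

end Equiv

/-- Two Weil–Deligne representations (possibly on different spaces) are *isomorphic*.
Ref: Deligne, Antwerp II (1973), §8.4.1. [cite: II1973] -/
def IsEquivalent (r : WeilDeligneRep F C V) (r' : WeilDeligneRep F C V') : Prop :=
  Nonempty (Equiv r r')

/-! ### The contragredient -/

/-- `dualMap` is compatible with powers: `(f ^ k)ᵀ = (fᵀ) ^ k`.
Ref: Bourbaki, *Algèbre* II §2.5. [folklore] -/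
theorem _root_.LinearMap.dualMap_pow {R M : Type*} [CommSemiring R] [AddCommMonoid M]
    [Module R M] (f : M →ₗ[R] M) (k : ℕ) : (f ^ k).dualMap = f.dualMap ^ k := by
  induction k with
  | zero =>
    simp only [pow_zero, Module.End.one_eq_id]
    exact LinearMap.dualMap_id
  | succ k ih =>
    rw [pow_succ, pow_succ', Module.End.mul_eq_comp, Module.End.mul_eq_comp,
      ← LinearMap.dualMap_comp_dualMap, ih]

/-- The transpose of a nilpotent endomorphism is nilpotent.
Ref: Bourbaki, *Algèbre* II §2.5. [folklore] -/
theorem _root_.IsNilpotent.dualMap {R M : Type*} [CommSemiring R] [AddCommMonoid M]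
    [Module R M] {f : M →ₗ[R] M} (hf : IsNilpotent f) : IsNilpotent f.dualMap := by
  obtain ⟨k, hk⟩ := hf
  exact ⟨k, by rw [← LinearMap.dualMap_pow, hk]; ext; simp⟩

/-- The **contragredient** (dual) Weil–Deligne representation on `Module.Dual C V`:
`ρ^∨(w) = ρ(w⁻¹)ᵀ` (Mathlib `Representation.dual`) and `N^∨ = -Nᵀ`.  The Weil–Deligne relation
for `(ρ^∨, N^∨)` follows from the one for `(ρ, N)` at `w⁻¹`, using `(q : C) ^ deg w ≠ 0`.
The `LocalGaloisGroup` named facts `IsFrobPow.mul`, `IsFrobPow.unique` (needed for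
`WeilGroup.deg_inv`) are the explicit hypotheses `hmul`, `huniq` (D-0014).
Ref: Deligne, Antwerp II (1973), §8.4.1; Tate, Corvallis 1979, (4.1.2), (4.1.6). [cite: II1973] -/
def dual (hmul : IsFrobPow.mul (F := F)) (huniq : IsFrobPow.unique (F := F))
    (r : WeilDeligneRep F C V) : WeilDeligneRep F C (Module.Dual C V) where
  ρ := r.ρ.dual
  isContinuous := by
    obtain ⟨U, hU, hUo, hρ⟩ := r.isContinuous
    refine ⟨U, hU, hUo, fun u hu => ?_⟩
    ext f v
    simp [Module.Dual.transpose_apply, hρ u⁻¹ (U.inv_mem hu)]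
  N := -r.N.dualMap
  isNilpotent_N := IsNilpotent.neg (R := Module.End C (Module.Dual C V)) r.isNilpotent_N.dualMap
  conj_N w := by
    ext f v
    have hq := residueFieldCard_zpow_ne_zero (F := F) (C := C) (deg w)
    simp only [LinearMap.comp_neg, LinearMap.neg_comp, LinearMap.neg_apply, LinearMap.smul_apply,
      LinearMap.coe_comp, Function.comp_apply, Representation.dual_apply,
      Module.Dual.transpose_apply, LinearMap.dualMap_apply, LinearMap.neg_apply,
      r.ρ_N_apply w⁻¹, deg_inv hmul huniq, zpow_neg, map_smul, smul_eq_mul, LinearMap.smul_apply]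
    rw [mul_neg, ← mul_assoc, mul_inv_cancel₀ hq, one_mul]

/-- The monodromy of the dual is `-Nᵀ`.  Ref: Deligne, Antwerp II (1973), §8.4.1. [cite: II1973] -/
@[simp] theorem dual_N (hmul : IsFrobPow.mul (F := F)) (huniq : IsFrobPow.unique (F := F))
    (r : WeilDeligneRep F C V) : (r.dual hmul huniq).N = -r.N.dualMap := rfl

/-- The representation of the dual is the dual representation.
Ref: Deligne, Antwerp II (1973), §8.4.1. [cite: II1973] -/
@[simp] theorem dual_ρ (hmul : IsFrobPow.mul (F := F)) (huniq : IsFrobPow.unique (F := F))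
    (r : WeilDeligneRep F C V) : (r.dual hmul huniq).ρ = r.ρ.dual := rfl

/-! ### Frobenius-semisimplicity, irreducibility -/

/-- A Weil–Deligne representation is **Frobenius-semisimple** if every `ρ(w)` is a semisimple
endomorphism (Mathlib `Module.End.IsSemisimple`); equivalently (finite-dimensional `V`) `ρ(Φ)`
is semisimple for one/any Frobenius `Φ`.
Ref: Deligne, Antwerp II (1973), §8.6; Tate, Corvallis 1979, (4.1.3). [cite: II1973] -/
def IsFrobSemisimple (r : WeilDeligneRep F C V) : Prop :=
  ∀ w : WeilGroup F, Module.End.IsSemisimple (r.ρ w)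

/-- A submodule `p ≤ V` is a *sub-Weil–Deligne representation*: stable under all `ρ(w)` and
under `N`.  Ref: Deligne, Antwerp II (1973), §8.4.1. [cite: II1973] -/
def IsSubrep (r : WeilDeligneRep F C V) (p : Submodule C V) : Prop :=
  (∀ w : WeilGroup F, p ≤ p.comap (r.ρ w)) ∧ p ≤ p.comap r.N

/-- A Weil–Deligne representation is **irreducible** if `V ≠ 0` and the only subspaces stable
under `ρ(W_F)` and `N` are `⊥` and `⊤` (then necessarily `N = 0`).
Ref: Deligne, Antwerp II (1973), §8.4.1; Tate, Corvallis 1979, (4.1.3)–(4.1.5). [cite: II1973] -/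
def IsIrreducible (r : WeilDeligneRep F C V) : Prop :=
  Nontrivial V ∧ ∀ p : Submodule C V, r.IsSubrep p → p = ⊥ ∨ p = ⊤

/-- A Weil–Deligne representation is **indecomposable** if `V ≠ 0` and it is not the direct sum
of two non-zero sub-Weil–Deligne representations.
Ref: Deligne, Antwerp II (1973), §8.4.1; Tate, Corvallis 1979, (4.1.5). [cite: II1973] -/
def IsIndecomposable (r : WeilDeligneRep F C V) : Prop :=
  Nontrivial V ∧ ∀ p p' : Submodule C V, r.IsSubrep p → r.IsSubrep p' → IsCompl p p' →
    p = ⊥ ∨ p' = ⊥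

/-- `r'` is a **Frobenius-semisimplification** of `r` (on the same space `V`): same monodromy
`N`, same restriction to inertia, and for every `w`, `r'.ρ w` is the semisimple part of `r.ρ w`
in its (additive) Jordan–Chevalley decomposition, i.e. `r'.ρ w` is semisimple and
`r.ρ w = r'.ρ w + n` with `n` nilpotent commuting with `r'.ρ w` (Mathlib
`Module.End.exists_isNilpotent_isSemisimple`).  Since `r.ρ w` is invertible this is also the
semisimple part of the multiplicative Jordan decomposition `ρ(w) = ρ(w)_ss · ρ(w)_u`.
Ref: Deligne, Antwerp II (1973), §8.5–8.6; Tate, Corvallis 1979, (4.1.3). [cite: II1973] -/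
def IsFrobSemisimplificationOf (r' r : WeilDeligneRep F C V) : Prop :=
  r'.N = r.N ∧ (∀ u ∈ inertia F, r'.ρ u = r.ρ u) ∧
    ∀ w : WeilGroup F, Module.End.IsSemisimple (r'.ρ w) ∧
      ∃ n : Module.End C V, IsNilpotent n ∧ Commute n (r'.ρ w) ∧ r.ρ w = r'.ρ w + n

/-- A Frobenius-semisimplification is Frobenius-semisimple (by definition).
Ref: Deligne, Antwerp II (1973), §8.6. [cite: II1973] -/
theorem IsFrobSemisimplificationOf.isFrobSemisimple {r' r : WeilDeligneRep F C V}
    (h : r'.IsFrobSemisimplificationOf r) : r'.IsFrobSemisimple := fun w => (h.2.2 w).1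

/-- A Frobenius-semisimple representation is its own Frobenius-semisimplification.
Ref: Deligne, Antwerp II (1973), §8.6. [cite: II1973] -/
theorem IsFrobSemisimple.isFrobSemisimplificationOf_self {r : WeilDeligneRep F C V}
    (h : r.IsFrobSemisimple) : r.IsFrobSemisimplificationOf r :=
  ⟨rfl, fun _ _ => rfl, fun w => ⟨h w, 0, IsNilpotent.zero, Commute.zero_left _, by simp⟩⟩

/-- **Existence and uniqueness of the Frobenius-semisimplification** (finite-dimensional `V`,
perfect coefficient field): `w ↦ ρ(w)_ss` is again a representation with open kernel on
inertia satisfying the Weil–Deligne relation with the same `N`, and it is the unique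
Frobenius-semisimplification of `(ρ, N)`.  Named fact (D-0014).
Ref: Deligne, Antwerp II (1973), §8.5–8.6; Tate, Corvallis 1979, (4.1.3). [cite: II1973] -/
def existsUnique_frobSemisimplification : Prop :=
  ∀ [PerfectField C] [FiniteDimensional C V] (r : WeilDeligneRep F C V),
    ∃! r' : WeilDeligneRep F C V, r'.IsFrobSemisimplificationOf r

end Basic

/-! ### Inertia invariants of `ker N` and the Euler factor -/

section Euler

variable {C : Type*} [Field C] [CharZero C] {V : Type*} [AddCommGroup V] [Module C V]

/-- The subspace `(ker N)^{I_F} = ker N ⊓ V^{I_F}` of inertia-invariant vectors killed by the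
monodromy, on which the Euler factor is computed (Mathlib `Representation.invariants` of the
restriction of `ρ` to `WeilGroup.inertia F`).
Ref: Tate, *Number theoretic background* (Corvallis 1979), (4.1.6); Deligne, Antwerp II §8.12. [cite: Corvallis1979] -/
def inertiaInvariantsKerN (r : WeilDeligneRep F C V) : Submodule C V :=
  LinearMap.ker r.N ⊓ Representation.invariants (r.ρ.comp (inertia F).subtype)

/-- Membership in `(ker N)^{I_F}`.  Ref: Tate, Corvallis 1979, (4.1.6). [cite: Corvallis1979, (4.1.6] -/
theorem mem_inertiaInvariantsKerN_iff (r : WeilDeligneRep F C V) (v : V) :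
    v ∈ r.inertiaInvariantsKerN ↔ r.N v = 0 ∧ ∀ u ∈ inertia F, r.ρ u v = v := by
  simp only [inertiaInvariantsKerN, Submodule.mem_inf, LinearMap.mem_ker,
    Representation.mem_invariants, Subtype.forall, MonoidHom.coe_comp, Function.comp_apply,
    Subgroup.subtype_apply]

/-- `(ker N)^{I_F}` is stable under every `ρ(w)`: `N (ρ w v) = q ^ (-deg w) • ρ w (N v) = 0`
(this uses `(q : C) ^ deg w ≠ 0`) and `ρ u (ρ w v) = ρ w (ρ (w⁻¹ u w) v) = ρ w v` since `I_F`
is normal in `W_F` (`WeilGroup.inertia_normal`, from the `LocalGaloisGroup` named fact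
`absInertia_normal F`, hypothesis `hn`).
Ref: Tate, *Number theoretic background* (Corvallis 1979), (4.1.6). [cite: Corvallis1979] -/
theorem ρ_apply_mem_inertiaInvariantsKerN (hn : absInertia_normal F) (r : WeilDeligneRep F C V)
    (w : WeilGroup F) {v : V} (hv : v ∈ r.inertiaInvariantsKerN) :
    r.ρ w v ∈ r.inertiaInvariantsKerN := by
  rw [mem_inertiaInvariantsKerN_iff] at hv ⊢
  refine ⟨?_, fun u hu => ?_⟩
  · have h := r.ρ_N_apply w v
    rw [hv.1, map_zero] at h
    exact ((smul_eq_zero.mp h.symm).resolve_left (residueFieldCard_zpow_ne_zero (deg w)))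
  · have hmem : w⁻¹ * u * w ∈ inertia F := (inertia_normal hn).conj_mem' u hu w
    have := hv.2 _ hmem
    calc r.ρ u (r.ρ w v) = r.ρ (w * (w⁻¹ * u * w)) v := by simp [mul_assoc]
      _ = r.ρ w v := by rw [map_mul, Module.End.mul_apply, this]

/-- The action of `w ∈ W_F` on `(ker N)^{I_F}` (Mathlib `LinearMap.restrict`; stability needs
normality of inertia, hypothesis `hn : absInertia_normal F`).
Ref: Tate, *Number theoretic background* (Corvallis 1979), (4.1.6). [cite: Corvallis1979] -/
def restrictInertiaInvariantsKerN (hn : absInertia_normal F) (r : WeilDeligneRep F C V)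
    (w : WeilGroup F) : Module.End C r.inertiaInvariantsKerN :=
  (r.ρ w).restrict fun _ hv => r.ρ_apply_mem_inertiaInvariantsKerN hn w hv

/-- Unfolding lemma for `restrictInertiaInvariantsKerN`.  Ref: Tate, Corvallis 1979, (4.1.6). [cite: Corvallis1979, (4.1.6] -/
@[simp] theorem coe_restrictInertiaInvariantsKerN_apply (hn : absInertia_normal F)
    (r : WeilDeligneRep F C V) (w : WeilGroup F) (v : r.inertiaInvariantsKerN) :
    (r.restrictInertiaInvariantsKerN hn w v : V) = r.ρ w v := rfl

variable (F) in
/-- A chosen *geometric* Frobenius `Φ ∈ W_F`, `deg Φ = -1` (`‖Φ‖ = q⁻¹`; sign convention of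
`Literature.Prelude.GalRep.WeilGroup`): `WeilGroup.mk σ` for a chosen `σ ∈ Gal(F̄/F)` acting as the
`(-1)`-st Frobenius power on the residue field, which exists by the `LocalGaloisGroup` named fact
`exists_isFrobPow` — threaded as the explicit hypothesis `hex` (a deliberate *thread* choice, no
junk fallback; D-0014).  Nothing depends on the choice up to `I_F`.
Ref: Deligne, Antwerp II (1973), §2.2.4, §8.12; Tate, Corvallis 1979, (1.4.1). [cite: II1973] -/
def geomFrob (hex : exists_isFrobPow (F := F)) : WeilGroup F :=
  WeilGroup.mk (Classical.choose (hex (-1))) ⟨-1, Classical.choose_spec (hex (-1))⟩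

/-- `deg (geomFrob F) = -1` (given the facts `hmul huniq` characterising `deg`).
Ref: Deligne, Antwerp II (1973), §2.2.4. [cite: II1973] -/
@[simp] theorem deg_geomFrob (hmul : IsFrobPow.mul (F := F)) (huniq : IsFrobPow.unique (F := F))
    (hex : exists_isFrobPow (F := F)) : deg (geomFrob F hex) = -1 :=
  (deg_eq_iff hmul huniq).mpr (Classical.choose_spec (hex (-1)))

/-- For `N = 0` and `ρ` unramified, `(ker N)^{I_F} = V`.
Ref: Tate, *Number theoretic background* (Corvallis 1979), (4.1.6). [cite: Corvallis1979] -/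
theorem inertiaInvariantsKerN_ofRep_eq_top {ρ : Representation C (WeilGroup F) V}
    (h : IsUnramifiedRep ρ) : (ofRep ρ h.isContinuousRep).inertiaInvariantsKerN = ⊤ := by
  rw [eq_top_iff]
  intro v _
  rw [mem_inertiaInvariantsKerN_iff]
  exact ⟨rfl, fun u hu => by simp [h u hu]⟩

variable [FiniteDimensional C V]

/-- The **Euler factor** `det(1 - T · ρ(Φ) | (ker N)^{I_F}) ∈ C[T]` of a Weil–Deligne
representation, `Φ` a geometric Frobenius (`deg Φ = -1`).  Computed as `Matrix.charpolyRev`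
(`det (1 - X • M)`) of the matrix of `ρ(Φ)|_{(ker N)^{I_F}}` in the basis `Module.finBasis`, for
`Φ = geomFrob F hex`; independence of `Φ` and of the basis is `eulerFactor_eq`.  Hypotheses:
`hn : absInertia_normal F` (stability of `(ker N)^{I_F}`), `hex : exists_isFrobPow` (the
geometric Frobenius).
Ref: Tate, *Number theoretic background* (Corvallis 1979), (4.1.6); Deligne, Antwerp II §8.12. [cite: Corvallis1979] -/
def eulerFactor (r : WeilDeligneRep F C V) (hn : absInertia_normal F)
    (hex : exists_isFrobPow (F := F)) : Polynomial C :=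
  (LinearMap.toMatrix (finBasis C r.inertiaInvariantsKerN) (finBasis C r.inertiaInvariantsKerN)
    (r.restrictInertiaInvariantsKerN hn (geomFrob F hex))).charpolyRev

/-- **Specification of the Euler factor**: for *any* geometric Frobenius `Φ` (`deg Φ = -1`) and
any basis `b` of `(ker N)^{I_F}`, `eulerFactor r = det (1 - X • [ρ(Φ)|]_b)`.  (Two geometric
Frobenii differ by inertia, which acts trivially on `(ker N)^{I_F}`; `charpolyRev` is a
similarity invariant.)  Named fact (D-0014).
Ref: Tate, *Number theoretic background* (Corvallis 1979), (4.1.6). [cite: Corvallis1979] -/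
def eulerFactor_eq : Prop :=
  ∀ (hn : absInertia_normal F) (hex : exists_isFrobPow (F := F)) (r : WeilDeligneRep F C V)
    {Φ : WeilGroup F} (_hΦ : deg Φ = -1)
    {ι : Type*} [Fintype ι] [DecidableEq ι] (b : Basis ι C r.inertiaInvariantsKerN),
    r.eulerFactor hn hex =
      (LinearMap.toMatrix b b (r.restrictInertiaInvariantsKerN hn Φ)).charpolyRev

/-- The Euler factor has constant term `1` (`Matrix.eval_charpolyRev` at `0`).
Ref: Tate, Corvallis 1979, (4.1.6). [cite: Corvallis1979, (4.1.6] -/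
theorem eulerFactor_coeff_zero (r : WeilDeligneRep F C V) (hn : absInertia_normal F)
    (hex : exists_isFrobPow (F := F)) : (r.eulerFactor hn hex).coeff 0 = 1 := by
  unfold eulerFactor
  rw [Polynomial.coeff_zero_eq_eval_zero, Matrix.eval_charpolyRev]

end Euler

/-! ### The local `L`-factor over `ℂ` -/

section Complex

variable {V : Type*} [AddCommGroup V] [Module ℂ V] [FiniteDimensional ℂ V]

/-- The **local `L`-factor** `L(s, r) = det(1 - q^{-s} ρ(Φ) | (ker N)^{I_F})⁻¹` of a complex
Weil–Deligne representation, `Φ` a geometric Frobenius: the Euler factor evaluated at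
`T = q ^ (-s)` (`Complex.cpow`), inverted.  Junk value: at the finitely many poles the field
convention `0⁻¹ = 0` applies.  Hypotheses `hn hex` as for `eulerFactor`.
Ref: Tate, *Number theoretic background* (Corvallis 1979), (4.1.6), (3.3.1); Deligne, Antwerp II
(1973), §8.12, §3.3. [cite: Corvallis1979] -/
def lFactor (r : WeilDeligneRep F ℂ V) (hn : absInertia_normal F)
    (hex : exists_isFrobPow (F := F)) (s : ℂ) : ℂ :=
  ((r.eulerFactor hn hex).eval ((residueFieldCard F : ℂ) ^ (-s)))⁻¹

/-- Unfolding lemma for `lFactor`.  Ref: Tate, Corvallis 1979, (4.1.6). [cite: Corvallis1979, (4.1.6] -/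
theorem lFactor_def (r : WeilDeligneRep F ℂ V) (hn : absInertia_normal F)
    (hex : exists_isFrobPow (F := F)) (s : ℂ) :
    r.lFactor hn hex s = ((r.eulerFactor hn hex).eval ((residueFieldCard F : ℂ) ^ (-s)))⁻¹ := rfl

end Complex

end WeilDeligneRep

/-! ### Grothendieck's monodromy theorem (ℓ-adic representations of `W_F`) -/

section Monodromy

variable {E : Type*} [NontriviallyNormedField E] {n : ℕ}

/-- **Grothendieck's quasi-unipotence theorem.**  Let `E` be a non-trivially normed field in
which the residue cardinality `q` of `F` has norm `1` (the "`ℓ ≠ p`" hypothesis: e.g. `E` a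
finite extension of `ℚ_ℓ`, `ℓ ∤ q`; it excludes archimedean `E`), and let
`ρ : W_F →ₜ* GL_n(E)` be a continuous representation.  Then there is an open subgroup `U` of the
inertia group on which `ρ` is unipotent: `(ρ u - 1)` is nilpotent for all `u ∈ U`.
Ref: Serre–Tate, *Good reduction of abelian varieties*, Ann. of Math. 88 (1968), Appendix
(Grothendieck); Deligne, Antwerp II (1973), §8.4.2.  Named fact (D-0014). [cite: II1973] -/
def FramedRep.exists_isOpen_isNilpotent_sub_one : Prop :=
  ∀ (_hq : ‖(residueFieldCard F : E)‖ = 1) (ρ : FramedRep (WeilGroup F) E n),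
    ∃ U : Subgroup (WeilGroup F), U ≤ WeilGroup.inertia F ∧ IsOpen (U : Set (WeilGroup F)) ∧
      ∀ u ∈ U, IsNilpotent (((ρ u : GL (Fin n) E) : Matrix (Fin n) (Fin n) E) - 1)

/-- **The `ℓ`-adic ↦ Weil–Deligne dictionary** (Grothendieck–Deligne).  Under the hypotheses of
`FramedRep.exists_isOpen_isNilpotent_sub_one` and `CharZero E`, a continuous
`ρ : W_F →ₜ* GL_n(E)` determines a Weil–Deligne representation `r = (ρ_WD, N)` on `Fin n → E`:
there are a nilpotent matrix `N` (the matrix of `r.N`), a homomorphism `t : I_F → E`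
(the `ℓ`-adic tame character composed with `ℤ_ℓ(1) → E`), an open subgroup `U ≤ I_F` and a
geometric Frobenius `Φ` (`deg Φ = -1`) such that
* `ρ(u) = exp (t(u) N)` for `u ∈ U` (truncated exponential of a nilpotent matrix, Mathlib
  `IsNilpotent.exp`), and
* `ρ_WD(Φ^m u) = ρ(Φ^m u) · exp (-t(u) N)` for all `m ∈ ℤ`, `u ∈ I_F`.
The isomorphism class of `r` is independent of the choices.
Ref: Deligne, Antwerp II (1973), §8.4.2; Serre–Tate, Ann. of Math. 88 (1968), Appendix;
Tate, Corvallis 1979, (4.2.1).  Named fact (D-0014). [cite: II1973] -/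
def exists_weilDeligneRep_of_ladic : Prop :=
  ∀ [CharZero E] (_hq : ‖(residueFieldCard F : E)‖ = 1) (ρ : FramedRep (WeilGroup F) E n),
    ∃ (r : WeilDeligneRep F E (Fin n → E)) (t : WeilGroup.inertia F →* Multiplicative E)
      (U : Subgroup (WeilGroup F)) (Φ : WeilGroup F),
      U ≤ WeilGroup.inertia F ∧ IsOpen (U : Set (WeilGroup F)) ∧ WeilGroup.deg Φ = -1 ∧
      (∀ u : WeilGroup.inertia F, (u : WeilGroup F) ∈ U →
        ((ρ u : GL (Fin n) E) : Matrix (Fin n) (Fin n) E) =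
          IsNilpotent.exp ((t u).toAdd • LinearMap.toMatrix' r.N)) ∧
      (∀ (m : ℤ) (u : WeilGroup.inertia F),
        LinearMap.toMatrix' (r.ρ (Φ ^ m * u)) =
          ((ρ (Φ ^ m * u) : GL (Fin n) E) : Matrix (Fin n) (Fin n) E) *
            IsNilpotent.exp (-((t u).toAdd • LinearMap.toMatrix' r.N)))

end Monodromy

end Literature.NumberTheory.GaloisRepresentations
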